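/-
Copyright (c) 2026 the pub-hodgecm-mathlib formalisation cell (harness21).  Prover seat hodgecm-mathlib-F0P3a-p05 (g17): road «S3-ram» (LEAD F0P3a-plan (g12); owner∕table
F0P3a-p06 (g15)), the (a2) JUNCTION (J★) of F0P3a-p01 (g17), J-PACK v2 §3 «Fix-finite = ★ J4a transported along `M ↦ A·M`» (the engine's `hFfin` in the J₀-model); 2026-09-02.
-/
import Literature.NumberTheory.Automorphic.UnitaryLatticeTreeFormTransport        -- ★ p847249 (F0P3a-p01 (g16)): `isVertex_smul_form_iff`, `isVertex_formCongr_mapGL_inv_iff`; brings ★ `UnitaryLatticeTreeFrameChange` (`mapGL_mapGL_inv`), ★ `UnitaryLatticeTreeDefs` (`mapGL_injective`, `mapGL_mul`)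
import Literature.NumberTheory.Automorphic.UnitaryLatticeTreeDiagonalFixedBounded   -- ★ J4a p847368 (F0P3a-p01 (g16)): `finite_setOf_latticeGraphIso_diagonal_eq` (fixed vertices of a regular diagonal `T` form a finite set)
import Literature.NumberTheory.Automorphic.UnitaryLatticeTreeDiagonalLiteralAntidiagonalModel   -- ★ p847564 (this seat): `exists_unitary_diagonal_coe_eq_diagonal` (`T ∈ U(σ, diag d)`, `↑T = diag s`)
import HarnessLib

/-!
# The lattice graph of a hermitian space — FINITENESS OF THE FIXED-VERTEX SET TRANSPORTS TO EVERY MODEL `c • ᵗσ(P) H P`; the fixed vertices of the conjugated diagonal literal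
# `A·diag(s)·A⁻¹` in the `J₀`-model form a finite set (Kottwitz 1986 §3; Rogawski 1990 §4.9; Bruhat–Tits 1972 §10)

Topic `NumberTheory/Automorphic`; namespace `Literature.NumberTheory.Automorphic.UnitaryLatticeTree`.  THEOREMS ONLY (no definition, no instance, no notation, no named fact,
no `sorry`); kernel lane `--supports stmt-HodgeConjecture-24833`; §1 datum-free (`K` with `Valued K ℤᵐ⁰`, any `σ`, any rank `N`).  Cell `pub/hodgecm-mathlib` (D-0151), crux
H413; road «S3-ram» (Literature seeding, count-neutral), organ A′e, the JUNCTION (J★) `stub_signedStrataCount_typeOne_ram` of F0P3a-p01 (g16∕g17): the tree-induction engine ★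
p847302 `strataVec_total_eq_of_localLaw_of_root` needs `hFfin`, the finiteness of the set of `γ`-fixed vertices; ★ J4a (p847368) proves it in the DIAGONAL model (fixed vertices of a
regular diagonal `T` lie in a bounded interval of lattices, finite by ★ J4b p847325), and J-PACK v2 §3 asks for its transport to the `J₀`-model along `M ↦ A·M` (`diag d =
(−det diag d) • ᵗσ(A) J₀ A`, ★ J1; `γ = A·T·A⁻¹`).  THIS FILE is that transport (§1 for any model `c • ᵗσ(P) H P`, one direction suffices) and the composite (§2).

THE MATHEMATICS (elementary).  For `H′ = c • ᵗσ(P) H P` with `|c| = 1`, `v ↦ P⁻¹·v` maps vertices of the lattice graph of `H` to vertices of that of `H′` (★ p847249 §1–§2),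
injectively (`mapGL` is injective), and if `↑γ = P·↑γ′·P⁻¹` then `γ′·(P⁻¹v) = P⁻¹·(γ v)`, so `γ`-fixed vertices go to `γ′`-fixed vertices; a set with a finite injective image is
finite.  With `H = J₀`, `P = A`, `c = −det diag d`, `γ′ = T = diag(s) ∈ U(σ, diag d)`, ★ J4a gives the finiteness upstairs.
HONEST LABEL: HC_CM is proved only modulo the 2 remaining named inputs (hLiu418 24832, h413 24833) until rung 0 closes; nothing printed is asserted here (bookkeeping).

* §1 **`finite_setOf_latticeGraphIso_eq_of_model`** (model-finite ⇒ `H`-finite, any `N`).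
* §2 **`finite_setOf_latticeGraphIso_antidiagonal_eq_of_coe_eq_conj_diagonal`** (`Fix(A·diag(s)·A⁻¹)` finite in the `J₀`-model for a regular integral spectrum `s`; the `T`
  binder is ★ `exists_unitary_diagonal_coe_eq_diagonal`'s).
* §3 `v_vandermonde_le_of_forall_v_le_one`, **`finite_setOf_latticeGraphIso_eq_of_eigenframe`** (= the junction's socket `fixedSet_finite_of_eigenframe`, skeleton v3 :388:
  regularity as `s i ≠ s j`, norm-one `s`).

## References
* [Kottwitz1986] R. E. Kottwitz, *Base change for unit elements of Hecke algebras*, Compositio Math. 60 (1986), §3 (the fixed-point set of a regular elliptic element in the building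
  is bounded).
* [Rogawski1990] J. D. Rogawski, *Automorphic Representations of Unitary Groups in Three Variables*, Ann. of Math. Stud. 123 (1990), §4.9 pp. 54–55, Lemma 4.9.3.
* [BruhatTits1972] F. Bruhat, J. Tits, *Groupes réductifs sur un corps local I*, Publ. Math. IHÉS 41 (1972), §10 (functoriality of the lattice model in the form).
* [Serre1980Trees] J.-P. Serre, *Trees* (1980), Ch. II §1.1.
-/

set_option autoImplicit false

noncomputable section

open scoped Valued WithZero Matrix MatrixGroups

namespace Literature.NumberTheory.Automorphic.UnitaryLatticeTree

open Literature.NumberTheory.Automorphic Literature.NumberTheory.Automorphic.HermitianLattice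

variable {K : Type*} [Field K] [Valued K ℤᵐ⁰] {N : ℕ}

/-! ## §1 The fixed-vertex set moves to every model `c • ᵗσ(P) H P` along `M ↦ P⁻¹·M` -/

/-- **FIXED VERTICES: FINITENESS TRANSPORTS TO THE MODEL AND BACK.**  For a model `H′ = c • ᵗσ(P) H P` (`|c| = 1`), `γ ∈ U(σ, H)` and `γ′ ∈ U(σ, H′)` with `↑γ = P·↑γ′·P⁻¹`:
if the `γ′`-fixed vertices of the lattice graph of `H′` form a finite set, so do the `γ`-fixed vertices of the lattice graph of `H` (`v ↦ P⁻¹·v` is injective and carries fixed to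
fixed). [cite: BruhatTits1972, §10] [cite: Kottwitz1986, §3] [cite: Serre1980Trees, II.1.1] -/
theorem finite_setOf_latticeGraphIso_eq_of_model (σ : K →+* K) (ϖ : K) {c : K} (hc : Valued.v c = 1) (H : Matrix (Fin N) (Fin N) K) (P : GL (Fin N) K)
    {H' : Matrix (Fin N) (Fin N) K} (hH' : H' = c • formCongr σ P H)
    (γ : unitaryGroupOfForm σ H) (γ' : unitaryGroupOfForm σ H') (hγ : ((γ : GL (Fin N) K)) = P * (γ' : GL (Fin N) K) * P⁻¹)
    (hfin : {w : {M : Submodule 𝒪[K] (Fin N → K) // IsVertex σ ϖ H' M} | latticeGraphIso σ ϖ H' γ' w = w}.Finite) :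
    {v : {M : Submodule 𝒪[K] (Fin N → K) // IsVertex σ ϖ H M} | latticeGraphIso σ ϖ H γ v = v}.Finite := by
  subst hH'
  -- `Ψ : v ↦ P⁻¹·v`, a vertex of the model
  have hΨ : ∀ v : {M : Submodule 𝒪[K] (Fin N → K) // IsVertex σ ϖ H M}, IsVertex σ ϖ (c • formCongr σ P H) (mapGL P⁻¹ v.1) := fun v =>
    (isVertex_smul_form_iff σ ϖ hc _ _).2 ((isVertex_formCongr_mapGL_inv_iff σ ϖ H P v.1).2 v.2)
  let Ψ : {M : Submodule 𝒪[K] (Fin N → K) // IsVertex σ ϖ H M} → {M : Submodule 𝒪[K] (Fin N → K) // IsVertex σ ϖ (c • formCongr σ P H) M} :=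
    fun v => ⟨mapGL P⁻¹ v.1, hΨ v⟩
  have hinj : Set.InjOn Ψ {v | latticeGraphIso σ ϖ H γ v = v} := by
    intro v _ w _ h
    have h1 : mapGL P⁻¹ v.1 = mapGL P⁻¹ w.1 := congrArg Subtype.val h
    exact Subtype.ext (mapGL_injective P⁻¹ h1)
  refine Set.Finite.of_finite_image (hfin.subset ?_) hinj
  rintro _ ⟨v, hv, rfl⟩
  -- `γ′·(P⁻¹v) = P⁻¹·(γ v) = P⁻¹ v`
  have hv' : mapGL (γ : GL (Fin N) K) v.1 = v.1 := congrArg Subtype.val hv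
  have hγ' : ((γ' : GL (Fin N) K)) = P⁻¹ * (γ : GL (Fin N) K) * P := by
    rw [hγ]; group
  apply Subtype.ext
  change mapGL (γ' : GL (Fin N) K) (mapGL P⁻¹ v.1) = mapGL P⁻¹ v.1
  rw [hγ', mapGL_mul, mapGL_mul, mapGL_mapGL_inv, hv']

/-! ## §2 The junction's `hFfin`: the fixed vertices of the conjugated diagonal literal in the `J₀`-model form a finite set -/

/-- **`Fix(γ)` IS FINITE IN THE `J₀`-MODEL** for `γ ∈ U(σ, J₀)` with `↑γ = A·diag(s)·A⁻¹`, `A` the ★ frame of a diagonal unit form `diag d = (−det diag d) • ᵗσ(A) J₀ A` and `s`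
an integral REGULAR spectrum (`|δ| ≤ |(sᵢ − sⱼ)(sᵢ − sₖ)|`, `δ ≠ 0`): ★ J4a `finite_setOf_latticeGraphIso_diagonal_eq` in the diagonal model, transported by §1 (the engine's `hFfin` in
the J₀-model, J-PACK v2 §3). [cite: Kottwitz1986, §3] [cite: Rogawski1990, §4.9 Lemma 4.9.3] [cite: BruhatTits1972, §10] -/
theorem finite_setOf_latticeGraphIso_antidiagonal_eq_of_coe_eq_conj_diagonal [Finite 𝓀[K]] {σ : K →+* K} (hvσ : ∀ a, Valued.v (σ a) = Valued.v a) {ϖ : K}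
    (hϖ : Valued.v ϖ = WithZero.exp (-1 : ℤ)) {d : Fin 3 → K} (hd : ∀ i, Valued.v (d i) = 1) {A : GL (Fin 3) K}
    (hdA : Matrix.diagonal d = (-(Matrix.diagonal d).det) • formCongr σ A ((StdForm.antidiagonal 3).over K))
    {s : Fin 3 → K} (hs : ∀ l, Valued.v (s l) ≤ 1) {δ : K} (hδ0 : δ ≠ 0)
    (hδ : ∀ i j k : Fin 3, i ≠ j → i ≠ k → j ≠ k → Valued.v δ ≤ Valued.v ((s i - s j) * (s i - s k)))
    (T : unitaryGroupOfForm σ (Matrix.diagonal d)) (hT : ((T : GL (Fin 3) K) : Matrix (Fin 3) (Fin 3) K) = Matrix.diagonal s)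
    (γ : unitaryGroupOfForm σ ((StdForm.antidiagonal 3).over K))
    (hγA : ((γ : GL (Fin 3) K) : Matrix (Fin 3) (Fin 3) K) = (A : Matrix (Fin 3) (Fin 3) K) * Matrix.diagonal s * ((A⁻¹ : GL (Fin 3) K) : Matrix (Fin 3) (Fin 3) K)) :
    {v : {M : Submodule 𝒪[K] (Fin 3 → K) // IsVertex σ ϖ ((StdForm.antidiagonal 3).over K) M} |
      latticeGraphIso σ ϖ ((StdForm.antidiagonal 3).over K) γ v = v}.Finite := by
  have hc : Valued.v (-(Matrix.diagonal d).det) = 1 := by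
    rw [Valuation.map_neg, Matrix.det_diagonal, map_prod]
    exact Finset.prod_eq_one fun i _ => hd i
  have hγ : (γ : GL (Fin 3) K) = A * (T : GL (Fin 3) K) * A⁻¹ := by
    apply Units.ext
    rw [hγA, Units.val_mul, Units.val_mul, hT]
  exact finite_setOf_latticeGraphIso_eq_of_model σ ϖ hc _ A hdA γ T hγ (finite_setOf_latticeGraphIso_diagonal_eq hvσ hϖ hd hs hδ0 hδ T hT)

/-! ## §3 The junction's socket `fixedSet_finite_of_eigenframe` (skeleton v3 :388): regular spectrum as `s i ≠ s j`, norm-one entries -/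

/-- The Vandermonde product dominates each of its `(s i − s j)(s i − s k)` sub-products for an integral triple `s` (`|s l| ≤ 1`). [cite: Serre1980Trees, II.1.1] -/
theorem v_vandermonde_le_of_forall_v_le_one {s : Fin 3 → K} (hs : ∀ l, Valued.v (s l) ≤ 1) (i j k : Fin 3) (hij : i ≠ j) (hik : i ≠ k) (hjk : j ≠ k) :
    Valued.v ((s 0 - s 1) * (s 0 - s 2) * (s 1 - s 2)) ≤ Valued.v ((s i - s j) * (s i - s k)) := by
  have h1 : ∀ a b : Fin 3, Valued.v (s a - s b) ≤ 1 := fun a b => (Valuation.map_sub _ _ _).trans (max_le (hs a) (hs b))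
  have hperm : Valued.v ((s 0 - s 1) * (s 0 - s 2) * (s 1 - s 2)) = Valued.v ((s i - s j) * (s i - s k) * (s j - s k)) := by
    fin_cases i <;> fin_cases j <;> fin_cases k <;> simp only [Fin.isValue, Fin.zero_eta, Fin.mk_one, Fin.reduceFinMk] at hij hik hjk ⊢ <;>
      first
        | exact absurd rfl hij
        | exact absurd rfl hik
        | exact absurd rfl hjk
        | (congr 1; ring1)
        | (rw [← Valuation.map_neg]; congr 1; ring1)
  rw [hperm, map_mul]
  exact mul_le_of_le_one_right' (h1 j k)

/-- **`Fix(γ)` IS FINITE for `γ = A·diag(s)·A⁻¹` with a REGULAR norm-one spectrum** (`s i ≠ s j`, `s i·σ(s i) = 1`, `|s i| = 1`) — the junction's socket `fixedSet_finite_of_eigenframe`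
(F0P3a-p01 (g17) skeleton v3 :388), binder for binder: §2 with `δ = (s₀ − s₁)(s₀ − s₂)(s₁ − s₂)` and `T = diag(s) ∈ U(σ, diag d)` (★ `exists_unitary_diagonal_coe_eq_diagonal`).
[cite: Kottwitz1986, §3] [cite: Rogawski1990, §4.9 Lemma 4.9.3] [cite: BruhatTits1972, §10] -/
theorem finite_setOf_latticeGraphIso_eq_of_eigenframe {σ : K →+* K} {ϖ : K} (hvσ : ∀ a, Valued.v (σ a) = Valued.v a) (hϖ : Valued.v ϖ = WithZero.exp (-1 : ℤ)) [Finite 𝓀[K]]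
    {γ : unitaryGroupOfForm σ ((StdForm.antidiagonal 3).over K)}
    (d : Fin 3 → K) (hd : ∀ i, Valued.v (d i) = 1) (_hdσ : ∀ i, σ (d i) = d i)
    (A : GL (Fin 3) K) (hdA : Matrix.diagonal d = (-(Matrix.diagonal d).det) • formCongr σ A ((StdForm.antidiagonal 3).over K))
    (s : Fin 3 → K) (hsv : ∀ i, Valued.v (s i) = 1) (hsσ : ∀ i, s i * σ (s i) = 1)
    (hγA : ((γ : GL (Fin 3) K) : Matrix (Fin 3) (Fin 3) K) = (A : Matrix (Fin 3) (Fin 3) K) * Matrix.diagonal s * ((A⁻¹ : GL (Fin 3) K) : Matrix (Fin 3) (Fin 3) K))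
    (hreg : ∀ i j, i ≠ j → s i ≠ s j) :
    ({v | latticeGraphIso σ ϖ ((StdForm.antidiagonal 3).over K) γ v = v}).Finite := by
  have hs : ∀ l, Valued.v (s l) ≤ 1 := fun l => (hsv l).le
  have hδ0 : (s 0 - s 1) * (s 0 - s 2) * (s 1 - s 2) ≠ 0 :=
    mul_ne_zero (mul_ne_zero (sub_ne_zero.2 (hreg 0 1 (by decide))) (sub_ne_zero.2 (hreg 0 2 (by decide)))) (sub_ne_zero.2 (hreg 1 2 (by decide)))
  obtain ⟨T, hT⟩ := exists_unitary_diagonal_coe_eq_diagonal (σ := σ) d s hsσ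
  exact finite_setOf_latticeGraphIso_antidiagonal_eq_of_coe_eq_conj_diagonal hvσ hϖ hd hdA hs hδ0 (v_vandermonde_le_of_forall_v_le_one hs) T hT γ hγA

end Literature.NumberTheory.Automorphic.UnitaryLatticeTree

end
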